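import Literature.AnabelianGeometry.AbsoluteAnabelian.MonoidKummerMapsMonoAnalyticLiftProofs
import Literature.AnabelianGeometry.AbsoluteAnabelian.MonoidKummerMapsTCGLiftProofs
import Literature.AnabelianGeometry.AbsoluteAnabelian.MonoidKummerMapsUnitFibresProofs
import HarnessLib

/-!
# [AbsTopIII] Prop 3.2 (iv) / 3.3 (ii), [IUTchII] Rmk 1.11.1 (i): the `TLG` lifting sentence
# REDUCED to the bi-anabelian statement for `k̄^×` (the pair/model-data layer stripped)

Proof-only companion (theorems only, no new definitions) of `MonoidKummerMaps.lean` (seat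
abc-iut-L4-t2; S. Mochizuki, *Topics in Absolute Anabelian Geometry III*, Prop. 3.2 (iv) p. 72 with
proof pp. 72–73, Prop. 3.3 (ii) p. 74; *Inter-universal Teichmüller Theory II*, Rmk. 1.11.1 (i)
p. 50; kurims manuscripts, lit keys `paper:url-5493eb38cbb7`, `paper:url-5036b4059555`).  Row
"TLG lifting ⇐ LCFT facts by name" (abc-iut-L4-lead 2026-08-26, scope split with abc-iut-L4-t11),
STAGE 1.

After abc-iut-L6-t21's `TM ⇐ TLG` files and this seat's `TCG ⇐ TLG` files, every surjectivity
sentence of `MonoidKummerMaps.lean` is a kernel consequence of the ONE **`TLG` lifting sentence**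
("every admissible `Π ⥲ Π*` between MLF-Galois `TLG`-pairs lifts to an isomorphism of pairs").  Print
proves it (Prop. 3.2 (iv), pp. 72–73) "from considering the 'copy of `M_TM ⥲ 𝒪^⊳_k` embedded in
abelianizations of open subgroups of `G ⥲ G_k` via local class field theory' [cf., e.g., [Mzk9],
Proposition 1.2.1, (iii), (iv)]".  This file removes everything that is NOT local class field theory
from that sentence: the pairs, the model data `(Π_k ↠ G_k)`, the arithmetic kernels.  What remains is
the field-level **bi-anabelian statement for `k̄^×`**, taken here as an explicit HYPOTHESIS (NOT a new
named fact — it paraphrases the target; its derivation from the tree's reciprocity family is STAGE 2,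
memo `staging/L6/L6-d1/TLG-LIFTING-SCOPE.md`):

  (BA)  for MLFs `k₁, k₂` with algebraic closures and every isomorphism of TOPOLOGICAL groups
        `α : Gal(k̄₁/k₁) ⥲ Gal(k̄₂/k₂)` there is a multiplicative bijection `β : k̄₁^× ⥲ k̄₂^×` with
        `β(σ x) = α(σ) β(x)`;
  (BA_abs) the same for ABSTRACT group isomorphisms `α` (= (BA) + "finite-index subgroups of `G_k`
        are open", Nikolov–Segal / Jannsen–Wingberg: abstract isomorphisms of absolute Galois groups of
        MLFs are continuous — FACT, not typed here).

* `ModelMLFGaloisData.exists_tlgPair_iso_of_equivariant` — an `α`-equivariant `β` IS an isomorphism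
  of the model `TLG`-pairs over any `f : Π₁ ⥲ Π₂` covering `α`;
* `ModelMLFGaloisData.exists_galoisMulEquiv_of_map_ker_eq` / `…exists_galoisContinuousMulEquiv_of_monoAnalytic`
  — an admissible `f : Π₁ ⥲ Π₂` covers an abstract `α`; for model data with bijective open `ε_k`
  (mono-analytic type) it covers a TOPOLOGICAL `α`;
* `tlgLifting_of_biAnabelianUnits_abstract` — (BA_abs) ⇒ the `TLG` lifting sentence (all MLF-Galois
  `TLG`-pairs, admissible `f`); `tlgLifting_monoAnalytic_of_biAnabelianUnits` — (BA) ⇒ the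
  mono-analytic `TLG` lifting sentence;
* BY NAME: `galoisIsoLiftsToTMPairIsoOfMonoAnalytic_of_biAnabelianUnits`,
  `tcgPairIsoLiftsOfMonoAnalytic_of_biAnabelianUnits` — abc-iut-L4-t2's [IUTchII] Rmk. 1.11.1 (i)(a),(b)
  facts follow from (BA); `galoisIsoLiftsToTMPairIso_of_biAnabelianUnits_abstract`,
  `tcgLifting_of_biAnabelianUnits_abstract` — the `TM`/`TCG` lifting sentences with hypothesis
  predicates follow from (BA_abs); `unitPairIsoFibresOfType_of_biAnabelianUnits_abstract`,
  `unitPairIsoFibres_of_biAnabelianUnits_abstract` — with abc-iut-L6-t21's two-lift theorem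
  (`MonoidKummerMapsUnitFibresProofs`), the corrected Prop. 3.3 (ii) schema `UnitPairIsoFibresOfType H`
  (both clauses) and the pre-erratum named fact `UnitPairIsoFibres` follow from (BA_abs).

HONEST FRAMING: OUR kernel check of a reduction between statements of refereed papers; nothing here
bears on [IUTchIII] Cor. 3.12.
-/

noncomputable section

open scoped Classical nonZeroDivisors

namespace Literature.AnabelianGeometry.AbsoluteAnabelian

/-! ### §1. Model level: equivariant `β` ⇒ isomorphism of `TLG`-pairs; `f` covers an `α` -/

section Model

variable {C₁ C₂ : MLFClosure.{0}} (D₁ : ModelMLFGaloisData C₁.k C₁.K) (D₂ : ModelMLFGaloisData C₂.k C₂.K)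

/-- An `α`-equivariant multiplicative bijection `β : k̄₁^× ⥲ k̄₂^×`, for `α : Gal(k̄₁/k₁) ⥲ Gal(k̄₂/k₂)`
covered by `f : Π₁ ⥲ Π₂` (`α ∘ ε₁ = ε₂ ∘ f`), is an isomorphism of the model `TLG`-pairs
`(Π₁ ↷ k̄₁^×) ⥲ (Π₂ ↷ k̄₂^×)` with Galois component `f`.
[cite: MochizukiAbsTopIII2015, Definition 3.1 (ii) p.67] -/
theorem ModelMLFGaloisData.exists_tlgPair_iso_of_equivariant (f : D₁.Pi ≃ₜ* D₂.Pi)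
    (α : (C₁.K ≃ₐ[C₁.k] C₁.K) ≃* (C₂.K ≃ₐ[C₂.k] C₂.K)) (hα : ∀ g, α (D₁.aug g) = D₂.aug (f g))
    (β : (C₁.K)⁰ ≃* (C₂.K)⁰)
    (hβ : ∀ (σ : C₁.K ≃ₐ[C₁.k] C₁.K) (x y : (C₁.K)⁰), (y : C₁.K) = σ x →
      ((β y : (C₂.K)⁰) : C₂.K) = α σ ((β x : (C₂.K)⁰) : C₂.K)) :
    ∃ e : GaloisMonoidPair.Iso D₁.tlgPair D₂.tlgPair, e.isoPi = f := by
  refine ⟨⟨f, β, fun g x => Subtype.ext ?_⟩, rfl⟩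
  show ((β (g • x) : (C₂.K)⁰) : C₂.K) = D₂.aug (f g) • ((β x : (C₂.K)⁰) : C₂.K)
  rw [AlgEquiv.smul_def, ← hα]
  exact hβ (D₁.aug g) x (g • x) rfl

/-- An admissible `f : Π₁ ⥲ Π₂` (one carrying `Ker ε₁` onto `Ker ε₂`) covers an (abstract) group
isomorphism `α : Gal(k̄₁/k₁) ⥲ Gal(k̄₂/k₂)`, `α ∘ ε₁ = ε₂ ∘ f` (the `ε_k` are surjective).
[cite: MochizukiAbsTopIII2015, Definition 3.1 (ii) p.67] -/
theorem ModelMLFGaloisData.exists_galoisMulEquiv_of_map_ker_eq (f : D₁.Pi ≃ₜ* D₂.Pi)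
    (hf : D₁.aug.ker.map f.toMulEquiv.toMonoidHom = D₂.aug.ker) :
    ∃ α : (C₁.K ≃ₐ[C₁.k] C₁.K) ≃* (C₂.K ≃ₐ[C₂.k] C₂.K), ∀ g, α (D₁.aug g) = D₂.aug (f g) := by
  let e₁ := QuotientGroup.quotientKerEquivOfSurjective D₁.aug D₁.aug_surjective
  let e₂ := QuotientGroup.quotientKerEquivOfSurjective D₂.aug D₂.aug_surjective
  let m : D₁.Pi ⧸ D₁.aug.ker ≃* D₂.Pi ⧸ D₂.aug.ker :=
    QuotientGroup.congr D₁.aug.ker D₂.aug.ker f.toMulEquiv hf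
  have he₁ : ∀ g, e₁ (QuotientGroup.mk g) = D₁.aug g := fun g => rfl
  have he₂ : ∀ g, e₂ (QuotientGroup.mk g) = D₂.aug g := fun g => rfl
  refine ⟨e₁.symm.trans (m.trans e₂), fun g => ?_⟩
  have h1 : e₁.symm (D₁.aug g) = QuotientGroup.mk g := by
    rw [MulEquiv.symm_apply_eq]; exact (he₁ g).symm
  rw [MulEquiv.trans_apply, MulEquiv.trans_apply, h1, QuotientGroup.congr_mk]
  exact he₂ (f g)

/-- For model data of mono-analytic type (`ε_k` bijective and open) every `f : Π₁ ⥲ Π₂` covers an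
isomorphism of TOPOLOGICAL groups `α : Gal(k̄₁/k₁) ⥲ Gal(k̄₂/k₂)` (`α = ε₂ ∘ f ∘ ε₁⁻¹`).
[cite: MochizukiAbsTopIII2015, Definition 3.1 (ii) p.67] -/
theorem ModelMLFGaloisData.exists_galoisContinuousMulEquiv_of_monoAnalytic
    (h₁ : Function.Bijective D₁.aug ∧ IsOpenMap D₁.aug) (h₂ : Function.Bijective D₂.aug ∧ IsOpenMap D₂.aug)
    (f : D₁.Pi ≃ₜ* D₂.Pi) :
    ∃ α : (C₁.K ≃ₐ[C₁.k] C₁.K) ≃ₜ* (C₂.K ≃ₐ[C₂.k] C₂.K), ∀ g, α (D₁.aug g) = D₂.aug (f g) := by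
  let a₁ : D₁.Pi ≃* (C₁.K ≃ₐ[C₁.k] C₁.K) := MulEquiv.ofBijective D₁.aug h₁.1
  let a₂ : D₂.Pi ≃* (C₂.K ≃ₐ[C₂.k] C₂.K) := MulEquiv.ofBijective D₂.aug h₂.1
  let t₁ : D₁.Pi ≃ₜ (C₁.K ≃ₐ[C₁.k] C₁.K) :=
    (Equiv.ofBijective D₁.aug h₁.1).toHomeomorphOfContinuousOpen D₁.continuous_aug h₁.2
  let t₂ : D₂.Pi ≃ₜ (C₂.K ≃ₐ[C₂.k] C₂.K) :=
    (Equiv.ofBijective D₂.aug h₂.1).toHomeomorphOfContinuousOpen D₂.continuous_aug h₂.2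
  let e : (C₁.K ≃ₐ[C₁.k] C₁.K) ≃* (C₂.K ≃ₐ[C₂.k] C₂.K) := a₁.symm.trans (f.toMulEquiv.trans a₂)
  -- `e` and `e.symm` as composites of homeomorphisms
  have hsymm₁ : ∀ σ, a₁.symm σ = t₁.symm σ := fun σ => by
    apply h₁.1.1
    show D₁.aug (a₁.symm σ) = D₁.aug (t₁.symm σ)
    have ha : D₁.aug (a₁.symm σ) = σ := a₁.apply_symm_apply σ
    have ht : D₁.aug (t₁.symm σ) = σ := t₁.apply_symm_apply σ
    rw [ha, ht]
  have hsymm₂ : ∀ τ, a₂.symm τ = t₂.symm τ := fun τ => by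
    apply h₂.1.1
    show D₂.aug (a₂.symm τ) = D₂.aug (t₂.symm τ)
    have ha : D₂.aug (a₂.symm τ) = τ := a₂.apply_symm_apply τ
    have ht : D₂.aug (t₂.symm τ) = τ := t₂.apply_symm_apply τ
    rw [ha, ht]
  have he : ∀ σ, e σ = t₂ (f (t₁.symm σ)) := fun σ => by
    show a₂ (f (a₁.symm σ)) = _
    rw [hsymm₁]; rfl
  have hes : ∀ τ, e.symm τ = t₁ (f.symm (t₂.symm τ)) := fun τ => by
    show a₁ (f.toMulEquiv.symm (a₂.symm τ)) = _
    rw [hsymm₂]; rfl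
  refine ⟨{ e with
    continuous_toFun := ?_, continuous_invFun := ?_ }, fun g => ?_⟩
  · show Continuous e
    rw [show (e : _ → _) = fun σ => t₂ (f (t₁.symm σ)) from funext he]
    exact t₂.continuous.comp (f.continuous.comp t₁.symm.continuous)
  · show Continuous e.symm
    rw [show (e.symm : _ → _) = fun τ => t₁ (f.symm (t₂.symm τ)) from funext hes]
    exact t₁.continuous.comp (f.symm.continuous.comp t₂.symm.continuous)
  · show e (D₁.aug g) = D₂.aug (f g)
    show a₂ (f (a₁.symm (D₁.aug g))) = _
    have : a₁.symm (D₁.aug g) = g := by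
      rw [MulEquiv.symm_apply_eq]; rfl
    rw [this]; rfl

end Model

/-! ### §2. Pair level: the `TLG` lifting sentences from the bi-anabelian statement -/

/-- **`TLG` lifting FROM (BA_abs).**  If every ABSTRACT isomorphism of absolute Galois groups of MLFs
lifts to an equivariant multiplicative bijection of the `k̄^×`, then every admissible `Π ⥲ Π*` between
MLF-Galois `TLG`-pairs lifts to an isomorphism of pairs (the hypothesis-free `TLG` lifting sentence;
(BA_abs) = (BA) + continuity of abstract isomorphisms, see the module docstring).
[cite: MochizukiAbsTopIII2015, Proposition 3.3 (ii) p.74] -/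
theorem tlgLifting_of_biAnabelianUnits_abstract
    (hBA : ∀ (C₁ C₂ : MLFClosure.{0}) (α : (C₁.K ≃ₐ[C₁.k] C₁.K) ≃* (C₂.K ≃ₐ[C₂.k] C₂.K)),
      ∃ β : (C₁.K)⁰ ≃* (C₂.K)⁰, ∀ (σ : C₁.K ≃ₐ[C₁.k] C₁.K) (x y : (C₁.K)⁰), (y : C₁.K) = σ x →
        ((β y : (C₂.K)⁰) : C₂.K) = α σ ((β x : (C₂.K)⁰) : C₂.K))
    (P Q : GaloisMonoidPair.{0}) (hP : IsMLFGaloisMonoidPair .TLG P) (hQ : IsMLFGaloisMonoidPair .TLG Q)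
    (f : P.Pi ≃ₜ* Q.Pi) (hf : P.actionKer.map f.toMulEquiv.toMonoidHom = Q.actionKer) :
    ∃ e : GaloisMonoidPair.Iso P Q, e.isoPi = f := by
  obtain ⟨C₁, D₁, P₁, hP₁, ⟨ι₁⟩⟩ := hP.exists_model
  obtain ⟨C₂, D₂, Q₂, hQ₂, ⟨ι₂⟩⟩ := hQ.exists_model
  rw [ModelMLFGaloisData.monoidPair_TLG, Option.some.injEq] at hP₁ hQ₂
  subst hP₁
  subst hQ₂
  set f' : D₁.Pi ≃ₜ* D₂.Pi := ι₁.isoPi.trans (f.trans ι₂.isoPi.symm) with hf'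
  have hf'k : D₁.aug.ker.map f'.toMulEquiv.toMonoidHom = D₂.aug.ker := by
    have hcomp : f'.toMulEquiv.toMonoidHom = ι₂.isoPi.symm.toMulEquiv.toMonoidHom.comp
        (f.toMulEquiv.toMonoidHom.comp ι₁.isoPi.toMulEquiv.toMonoidHom) := MonoidHom.ext fun _ => rfl
    rw [← ModelMLFGaloisData.tlgPair_actionKer C₁ D₁, ← ModelMLFGaloisData.tlgPair_actionKer C₂ D₂, hcomp,
      ← Subgroup.map_map, ← Subgroup.map_map, ι₁.map_actionKer, hf, ι₂.symm_map_actionKer]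
  obtain ⟨α, hα⟩ := ModelMLFGaloisData.exists_galoisMulEquiv_of_map_ker_eq D₁ D₂ f' hf'k
  obtain ⟨β, hβ⟩ := hBA C₁ C₂ α
  obtain ⟨e₁, he₁⟩ := ModelMLFGaloisData.exists_tlgPair_iso_of_equivariant D₁ D₂ f' α hα β hβ
  refine ⟨⟨f, ι₁.isoM.symm.trans (e₁.isoM.trans ι₂.isoM), fun g x => ?_⟩, rfl⟩
  show ι₂.isoM (e₁.isoM (ι₁.isoM.symm (g • x))) = f g • ι₂.isoM (e₁.isoM (ι₁.isoM.symm x))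
  rw [GaloisMonoidPair.Iso.symm_smul_comm, e₁.smul_comm, ι₂.smul_comm, he₁]
  show ι₂.isoPi (ι₂.isoPi.symm (f (ι₁.isoPi (ι₁.isoPi.symm g)))) • _ = _
  rw [ContinuousMulEquiv.apply_symm_apply, ContinuousMulEquiv.apply_symm_apply]

/-- **Mono-analytic `TLG` lifting FROM (BA).**  If every isomorphism of TOPOLOGICAL absolute Galois
groups of MLFs lifts to an equivariant multiplicative bijection of the `k̄^×` (the local-class-field-
theoretic input of Prop. 3.2 (iv), proof pp. 72–73), then every `Π ⥲ Π*` between MLF-Galois `TLG`-pairs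
of mono-analytic type lifts to an isomorphism of pairs.
[cite: MochizukiAbsTopIII2015, Proposition 3.2 (iv) p.72] -/
theorem tlgLifting_monoAnalytic_of_biAnabelianUnits
    (hBA : ∀ (C₁ C₂ : MLFClosure.{0}) (α : (C₁.K ≃ₐ[C₁.k] C₁.K) ≃ₜ* (C₂.K ≃ₐ[C₂.k] C₂.K)),
      ∃ β : (C₁.K)⁰ ≃* (C₂.K)⁰, ∀ (σ : C₁.K ≃ₐ[C₁.k] C₁.K) (x y : (C₁.K)⁰), (y : C₁.K) = σ x →
        ((β y : (C₂.K)⁰) : C₂.K) = α σ ((β x : (C₂.K)⁰) : C₂.K))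
    (P Q : GaloisMonoidPair.{0}) (_hP : IsMLFGaloisMonoidPair .TLG P) (_hQ : IsMLFGaloisMonoidPair .TLG Q)
    (hPm : IsOfMonoAnalyticTypeMonoid .TLG P) (hQm : IsOfMonoAnalyticTypeMonoid .TLG Q)
    (f : P.Pi ≃ₜ* Q.Pi) : ∃ e : GaloisMonoidPair.Iso P Q, e.isoPi = f := by
  obtain ⟨C₁, D₁, P₁, hb₁, hP₁, ⟨ι₁⟩⟩ := hPm.exists_model
  obtain ⟨C₂, D₂, Q₂, hb₂, hQ₂, ⟨ι₂⟩⟩ := hQm.exists_model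
  rw [ModelMLFGaloisData.monoidPair_TLG, Option.some.injEq] at hP₁ hQ₂
  subst hP₁
  subst hQ₂
  set f' : D₁.Pi ≃ₜ* D₂.Pi := ι₁.isoPi.trans (f.trans ι₂.isoPi.symm) with hf'
  obtain ⟨α, hα⟩ := ModelMLFGaloisData.exists_galoisContinuousMulEquiv_of_monoAnalytic D₁ D₂ hb₁ hb₂ f'
  obtain ⟨β, hβ⟩ := hBA C₁ C₂ α
  obtain ⟨e₁, he₁⟩ := ModelMLFGaloisData.exists_tlgPair_iso_of_equivariant D₁ D₂ f' α.toMulEquiv hα β hβ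
  refine ⟨⟨f, ι₁.isoM.symm.trans (e₁.isoM.trans ι₂.isoM), fun g x => ?_⟩, rfl⟩
  show ι₂.isoM (e₁.isoM (ι₁.isoM.symm (g • x))) = f g • ι₂.isoM (e₁.isoM (ι₁.isoM.symm x))
  rw [GaloisMonoidPair.Iso.symm_smul_comm, e₁.smul_comm, ι₂.smul_comm, he₁]
  show ι₂.isoPi (ι₂.isoPi.symm (f (ι₁.isoPi (ι₁.isoPi.symm g)))) • _ = _
  rw [ContinuousMulEquiv.apply_symm_apply, ContinuousMulEquiv.apply_symm_apply]

/-! ### §3. The named facts from the bi-anabelian statement -/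

/-- **[IUTchII] Rmk 1.11.1 (i)(a) FROM (BA)**: abc-iut-L4-t2's `GaloisIsoLiftsToTMPairIsoOfMonoAnalytic`
(mono-analytic `TM` lifting) follows from the bi-anabelian statement for `k̄^×` — via abc-iut-L6-t21's
`tmPairIso_lifts_of_tlgLifting_monoAnalytic`. [cite: Mochizuki2012, II Rmk 1.11.1 (i) p.50] -/
theorem galoisIsoLiftsToTMPairIsoOfMonoAnalytic_of_biAnabelianUnits
    (hBA : ∀ (C₁ C₂ : MLFClosure.{0}) (α : (C₁.K ≃ₐ[C₁.k] C₁.K) ≃ₜ* (C₂.K ≃ₐ[C₂.k] C₂.K)),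
      ∃ β : (C₁.K)⁰ ≃* (C₂.K)⁰, ∀ (σ : C₁.K ≃ₐ[C₁.k] C₁.K) (x y : (C₁.K)⁰), (y : C₁.K) = σ x →
        ((β y : (C₂.K)⁰) : C₂.K) = α σ ((β x : (C₂.K)⁰) : C₂.K)) :
    GaloisIsoLiftsToTMPairIsoOfMonoAnalytic := fun P Q hP hQ hPm hQm f =>
  tmPairIso_lifts_of_tlgLifting_monoAnalytic (tlgLifting_monoAnalytic_of_biAnabelianUnits hBA)
    P Q hP hQ hPm hQm f

/-- **[IUTchII] Rmk 1.11.1 (i)(b) FROM (BA)**: abc-iut-L4-t2's `TCGPairIsoLiftsOfMonoAnalytic` (every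
`(f, u)` between `TCG`-pairs of mono-analytic type is realised) follows from the bi-anabelian statement
for `k̄^×` — via `tcgPairIsoLiftsOfMonoAnalytic_of_tlgLifting` (the kernel half, `Aut = Ẑ^×`, being
PROVED). [cite: Mochizuki2012, II Rmk 1.11.1 (i) p.50] -/
theorem tcgPairIsoLiftsOfMonoAnalytic_of_biAnabelianUnits
    (hBA : ∀ (C₁ C₂ : MLFClosure.{0}) (α : (C₁.K ≃ₐ[C₁.k] C₁.K) ≃ₜ* (C₂.K ≃ₐ[C₂.k] C₂.K)),
      ∃ β : (C₁.K)⁰ ≃* (C₂.K)⁰, ∀ (σ : C₁.K ≃ₐ[C₁.k] C₁.K) (x y : (C₁.K)⁰), (y : C₁.K) = σ x →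
        ((β y : (C₂.K)⁰) : C₂.K) = α σ ((β x : (C₂.K)⁰) : C₂.K)) :
    TCGPairIsoLiftsOfMonoAnalytic :=
  tcgPairIsoLiftsOfMonoAnalytic_of_tlgLifting fun P Q hP hQ hPm hQm f =>
    tlgLifting_monoAnalytic_of_biAnabelianUnits hBA P Q hP hQ hPm hQm f

/-- **Prop 3.2 (iv) surjectivity (`TM`, schema over `H`) FROM (BA_abs)** — via abc-iut-L6-t21's
`galoisIsoLiftsToTMPairIso_of_tlgLifting`. [cite: MochizukiAbsTopIII2015, Proposition 3.2 (iv) p.72] -/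
theorem galoisIsoLiftsToTMPairIso_of_biAnabelianUnits_abstract
    (hBA : ∀ (C₁ C₂ : MLFClosure.{0}) (α : (C₁.K ≃ₐ[C₁.k] C₁.K) ≃* (C₂.K ≃ₐ[C₂.k] C₂.K)),
      ∃ β : (C₁.K)⁰ ≃* (C₂.K)⁰, ∀ (σ : C₁.K ≃ₐ[C₁.k] C₁.K) (x y : (C₁.K)⁰), (y : C₁.K) = σ x →
        ((β y : (C₂.K)⁰) : C₂.K) = α σ ((β x : (C₂.K)⁰) : C₂.K))
    (H : GaloisMonoidPair.{0} → Prop) : GaloisIsoLiftsToTMPairIso H :=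
  galoisIsoLiftsToTMPairIso_of_tlgLifting H (tlgLifting_of_biAnabelianUnits_abstract hBA)

/-- **Prop 3.3 (ii) `TCG` lifting (with hypothesis predicate) FROM (BA_abs)** — via
`tcgLifting_of_tlgLifting`. [cite: MochizukiAbsTopIII2015, Proposition 3.3 (ii) p.74] -/
theorem tcgLifting_of_biAnabelianUnits_abstract
    (hBA : ∀ (C₁ C₂ : MLFClosure.{0}) (α : (C₁.K ≃ₐ[C₁.k] C₁.K) ≃* (C₂.K ≃ₐ[C₂.k] C₂.K)),
      ∃ β : (C₁.K)⁰ ≃* (C₂.K)⁰, ∀ (σ : C₁.K ≃ₐ[C₁.k] C₁.K) (x y : (C₁.K)⁰), (y : C₁.K) = σ x →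
        ((β y : (C₂.K)⁰) : C₂.K) = α σ ((β x : (C₂.K)⁰) : C₂.K))
    (P Q : GaloisMonoidPair.{0}) (hP : IsMLFGaloisMonoidPair .TCG P) (hQ : IsMLFGaloisMonoidPair .TCG Q)
    (f : P.Pi ≃ₜ* Q.Pi) (hf : P.actionKer.map f.toMulEquiv.toMonoidHom = Q.actionKer) :
    ∃ e : GaloisMonoidPair.Iso P Q, e.isoPi = f :=
  tcgLifting_of_tlgLifting (tlgLifting_of_biAnabelianUnits_abstract hBA) P Q hP hQ f hf

/-- **Prop 3.3 (ii) corrected `TCG` clause (schema over `H`) FROM (BA_abs)**: the `TCG` conjunct of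
abc-iut-L4-t2's `UnitPairIsoFibresOfType H` — via `unitPairIsoFibresOfType_tcg_of_exists_lift`.  (The
`TLG` conjunct additionally needs the two-lift theorem of abc-iut-L6-t21's
`MonoidKummerMapsUnitFibresProofs`.) [cite: MochizukiAbsTopIII2015, Proposition 3.3 (ii) p.74]
[cite: MochizukiAbsTopIIIComments2019, item (5)] -/
theorem unitPairIsoFibresOfType_tcg_of_biAnabelianUnits_abstract
    (hBA : ∀ (C₁ C₂ : MLFClosure.{0}) (α : (C₁.K ≃ₐ[C₁.k] C₁.K) ≃* (C₂.K ≃ₐ[C₂.k] C₂.K)),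
      ∃ β : (C₁.K)⁰ ≃* (C₂.K)⁰, ∀ (σ : C₁.K ≃ₐ[C₁.k] C₁.K) (x y : (C₁.K)⁰), (y : C₁.K) = σ x →
        ((β y : (C₂.K)⁰) : C₂.K) = α σ ((β x : (C₂.K)⁰) : C₂.K))
    (H : GaloisMonoidPair.{0} → Prop) :
    ∀ (P Q : GaloisMonoidPair.{0}), IsMLFGaloisMonoidPair .TCG P → IsMLFGaloisMonoidPair .TCG Q →
      H P → H Q →
      ∀ f : P.Pi ≃ₜ* Q.Pi, P.actionKer.map f.toMulEquiv.toMonoidHom = Q.actionKer →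
      ∀ u : cyclotome P.M ≃* cyclotome Q.M,
        ∃ e : GaloisMonoidPair.Iso P Q, e.isoPi = f ∧
          ∀ ζ : cyclotome P.M,
            Literature.AnabelianGeometry.EtaleTheta.cyclotome.map (Units.map e.isoM.toMonoidHom) ζ = u ζ :=
  unitPairIsoFibresOfType_tcg_of_exists_lift H fun P Q hP hQ _ _ f hf =>
    tcgLifting_of_biAnabelianUnits_abstract hBA P Q hP hQ f hf

/-- **Prop 3.3 (ii) as corrected (BOTH clauses, schema over `H`) FROM (BA_abs)**: abc-iut-L4-t2's
`UnitPairIsoFibresOfType H` — `TCG` clause via `Aut(μ_Ẑ) = Ẑ^×` (this seat), `TLG` clause via the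
two-lift theorem `unitPairIso_fibre_two_of_exists_lift` (abc-iut-L6-t21).
[cite: MochizukiAbsTopIII2015, Proposition 3.3 (ii) p.74] [cite: MochizukiAbsTopIIIComments2019, item (5)] -/
theorem unitPairIsoFibresOfType_of_biAnabelianUnits_abstract
    (hBA : ∀ (C₁ C₂ : MLFClosure.{0}) (α : (C₁.K ≃ₐ[C₁.k] C₁.K) ≃* (C₂.K ≃ₐ[C₂.k] C₂.K)),
      ∃ β : (C₁.K)⁰ ≃* (C₂.K)⁰, ∀ (σ : C₁.K ≃ₐ[C₁.k] C₁.K) (x y : (C₁.K)⁰), (y : C₁.K) = σ x →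
        ((β y : (C₂.K)⁰) : C₂.K) = α σ ((β x : (C₂.K)⁰) : C₂.K))
    (H : GaloisMonoidPair.{0} → Prop) : UnitPairIsoFibresOfType H :=
  unitPairIsoFibresOfType_of_lifts H
    (fun P Q hP hQ _ _ f hf => tcgLifting_of_biAnabelianUnits_abstract hBA P Q hP hQ f hf)
    (fun P Q hP hQ _ _ f hf => unitPairIso_fibre_two_of_exists_lift P Q hP f
      (tlgLifting_of_biAnabelianUnits_abstract hBA P Q hP hQ f hf))

/-- **The pre-erratum named fact `UnitPairIsoFibres` FROM (BA_abs)** (via abc-iut-L6-t21's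
`unitPairIsoFibres_iff_exists_lift`: the fact is equivalent to the `TLG` lifting sentence).
[cite: MochizukiAbsTopIII2015, Proposition 3.3 (ii) p.74] -/
theorem unitPairIsoFibres_of_biAnabelianUnits_abstract
    (hBA : ∀ (C₁ C₂ : MLFClosure.{0}) (α : (C₁.K ≃ₐ[C₁.k] C₁.K) ≃* (C₂.K ≃ₐ[C₂.k] C₂.K)),
      ∃ β : (C₁.K)⁰ ≃* (C₂.K)⁰, ∀ (σ : C₁.K ≃ₐ[C₁.k] C₁.K) (x y : (C₁.K)⁰), (y : C₁.K) = σ x →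
        ((β y : (C₂.K)⁰) : C₂.K) = α σ ((β x : (C₂.K)⁰) : C₂.K)) :
    UnitPairIsoFibres :=
  unitPairIsoFibres_iff_exists_lift.mpr (tlgLifting_of_biAnabelianUnits_abstract hBA)

end Literature.AnabelianGeometry.AbsoluteAnabelian

end
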